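import Mathlib
import Summits.ValiantsHypothesis.ValiantsHypothesis.Theorems.BarrierLeverPartitionMinorsHitByVPHiddenStatesPathTableGood
import Summits.ValiantsHypothesis.ValiantsHypothesis.Theorems.BarrierLeverPartitionMinorsHitByVPHiddenStatesGradedColex

/-!
# Route BarrierLever — item `PartitionMinorsHitByVP` (stmt-ValiantsHypothesis-19717), line `hidden-states`:
# THE GC½ CELL «first shell of HALF-BALL, class `P_k`», EVERY `k`, in the item's table currency

Helper file (`--supports stmt-ValiantsHypothesis-19717`; cell valiant-natproofs, 𝒟-side door (c), registered line
`Cruxes/PartitionMinorsHitByVP/Lines/hidden_states.lean` v8; prover seat val-np-p6 gen 16).  Closes NO item; definition-free.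
Re-indexing of `PathTable.pathTable_det_ne_zero` (`…HiddenStatesPathTableGood`) from `Fin (k+1) ⊕ Fin k` to `Fin (2k+1)` along an
equivalence sending the X-summand onto a prescribed `k`-set `X`:
★★ `exists_table_firstShell_swap` — for every `k ≥ 2`, every `k`-subset `X ⊆ Fin (2k+1)`, every injective row family `u` with
`u i = Xᶜ` or (`|u i| ≤ k` and `u i ≠ X`) — i.e. ranging in `U = B_k − {X} + {Xᶜ}` — and every column family `cols` through which all
points `|J| ≤ k` occur, THERE IS A TABLE `tx` with `det [∏_{a ∈ u i} (tx none a + Σ_{q ∈ cols kk} tx (some q) a)]_{i,kk} ≠ 0`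
(the ONE-PIECE hidden-state design at the exact half `r = |B_k(2k+1)| = 2^{2k}`, `h = 2k+1`, `K = h`: the column sets ARE the
graded-colex family `B_k`).  This is the GC½ statement for the swap classes `B_k − X + Xᶜ` (memo HOME/val-np-p6/g16/MEMO-valnp6-g16.md;
with g15's exact-section reduction, on paper, the whole first shell for every `t`).

HONEST LABEL: one class of lower families per `k`; 19717 stays OPEN; nothing on crux 14610 or VP ≠ VNP.
-/

set_option linter.dupNamespace false

namespace Summit.ValiantsHypothesis.ValiantsHypothesis.Theorems.BarrierLever.HiddenStates

open Finset

noncomputable section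

namespace PathTable

/-- an equivalence `Fin (k+1) ⊕ Fin k ≃ Fin (2k+1)` sending the right summand onto the `k`-set `X` and the left one onto `Xᶜ`. -/
theorem exists_equiv_of_card {k : ℕ} (X : Finset (Fin (2 * k + 1))) (hX : X.card = k) :
    ∃ e : Fin (k + 1) ⊕ Fin k ≃ Fin (2 * k + 1), (∀ i, e (Sum.inr i) ∈ X) ∧ ∀ b, e (Sum.inl b) ∉ X := by
  classical
  have hXc : (Finset.univ.filter fun a : Fin (2 * k + 1) => a ∉ X).card = k + 1 := by
    have h1 : Finset.univ.filter (fun a : Fin (2 * k + 1) => a ∉ X) = Xᶜ := by ext a; simp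
    rw [h1, Finset.card_compl, hX, Fintype.card_fin]; omega
  let eX : Fin k ≃ {a // a ∈ X} := (X.equivFinOfCardEq hX).symm
  let eXc0 : Fin (k + 1) ≃ {a // a ∈ Finset.univ.filter fun a : Fin (2 * k + 1) => a ∉ X} :=
    ((Finset.univ.filter fun a : Fin (2 * k + 1) => a ∉ X).equivFinOfCardEq hXc).symm
  let eXc : Fin (k + 1) ≃ {a // a ∉ X} :=
    eXc0.trans (Equiv.subtypeEquivRight fun a => by simp)
  let e : Fin (k + 1) ⊕ Fin k ≃ Fin (2 * k + 1) :=
    ((Equiv.sumComm _ _).trans (Equiv.sumCongr eX eXc)).trans (Equiv.sumCompl fun a => a ∈ X)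
  refine ⟨e, fun i => ?_, fun b => ?_⟩
  · show (Equiv.sumCompl (fun a => a ∈ X)) (Sum.inl (eX i)) ∈ X
    rw [Equiv.sumCompl_apply_inl]; exact (eX i).2
  · show (Equiv.sumCompl (fun a => a ∈ X)) (Sum.inr (eXc b)) ∉ X
    rw [Equiv.sumCompl_apply_inr]; exact (eXc b).2

/-- ★★ **THE GC½ CELL FOR THE SWAP CLASSES `B_k − X + Xᶜ`, EVERY `k ≥ 2`.** -/
theorem exists_table_firstShell_swap (k : ℕ) (hk : 2 ≤ k) (X : Finset (Fin (2 * k + 1))) (hX : X.card = k)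
    {r : ℕ} (u cols : Fin r → Finset (Fin (2 * k + 1))) (hu : Function.Injective u)
    (hU : ∀ i, ((u i).card ≤ k ∧ u i ≠ X) ∨ u i = Xᶜ)
    (hcols : ∀ J : Finset (Fin (2 * k + 1)), J.card ≤ k → ∃ kk, cols kk = J) :
    ∃ tx : Option (Fin (2 * k + 1)) → Fin (2 * k + 1) → ℂ,
      (Matrix.of fun i kk : Fin r => ∏ a ∈ u i, (tx none a + ∑ q ∈ cols kk, tx (some q) a)).det ≠ 0 := by
  classical
  obtain ⟨e, heX, heXc⟩ := exists_equiv_of_card X hX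
  -- pull rows and columns back to the sum type
  let rowS : Fin r → Finset (Fin (k + 1) ⊕ Fin k) := fun i => (u i).map e.symm.toEmbedding
  let colJ : Fin r → Finset (Fin (k + 1) ⊕ Fin k) := fun kk => (cols kk).map e.symm.toEmbedding
  have hmapX : X.map e.symm.toEmbedding = (Finset.univ : Finset (Fin k)).image Sum.inr := by
    ext x
    rw [Finset.mem_map_equiv, Equiv.symm_symm, Finset.mem_image]
    rcases x with b | i
    · simp only [Finset.mem_univ, true_and]
      exact ⟨fun h => (heXc b h).elim, by rintro ⟨_, h⟩; cases h⟩
    · simp only [Finset.mem_univ, true_and]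
      exact ⟨fun _ => ⟨i, rfl⟩, fun _ => heX i⟩
  have hmapXc : Xᶜ.map e.symm.toEmbedding = (Finset.univ : Finset (Fin (k + 1))).image Sum.inl := by
    ext x
    rw [Finset.mem_map_equiv, Equiv.symm_symm, Finset.mem_image, Finset.mem_compl]
    rcases x with b | i
    · simp only [Finset.mem_univ, true_and]
      exact ⟨fun _ => ⟨b, rfl⟩, fun _ => heXc b⟩
    · simp only [Finset.mem_univ, true_and]
      exact ⟨fun h => (h (heX i)).elim, by rintro ⟨_, h⟩; cases h⟩
  have hinj : Function.Injective rowS := fun i j hij => hu (Finset.map_injective _ hij)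
  have hrow : ∀ i, ((rowS i).card ≤ k ∧ rowS i ≠ (Finset.univ : Finset (Fin k)).image Sum.inr) ∨
      rowS i = (Finset.univ : Finset (Fin (k + 1))).image Sum.inl := by
    intro i
    rcases hU i with ⟨hc, hne⟩ | h
    · left
      refine ⟨by simp only [rowS, Finset.card_map]; exact hc, fun h => hne ?_⟩
      rw [← hmapX] at h
      exact Finset.map_injective _ h
    · right; simp only [rowS, h, hmapXc]
  have hcol : ∀ J : Finset (Fin (k + 1) ⊕ Fin k), J.card ≤ k → ∃ kk, colJ kk = J := by
    intro J hJ
    obtain ⟨kk, hkk⟩ := hcols (J.map e.toEmbedding) (by rw [Finset.card_map]; exact hJ)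
    refine ⟨kk, ?_⟩
    simp only [colJ, hkk, Finset.map_map]
    convert Finset.map_refl (s := J)
    ext x; simp
  have hdet := pathTable_det_ne_zero (s := (1 : ℂ)) hk one_ne_zero rowS colJ hinj hrow hcol
  refine ⟨fun o a => match o with | none => 0 | some q => pw k 1 (e.symm a) (e.symm q), ?_⟩
  convert hdet using 2
  ext i kk
  simp only [Matrix.of_apply, zero_add, rowS, colJ, Finset.prod_map, Finset.sum_map]
  rfl

/-- the number of subsets of `Fin (2k+1)` of size `≤ k` is `2^{2k}`. -/
theorem card_ball_half (k : ℕ) :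
    (Finset.filter (fun J : Finset (Fin (2 * k + 1)) => J.card ≤ k) Finset.univ).card = 2 ^ (2 * k) := by
  classical
  have hdec : Finset.filter (fun J : Finset (Fin (2 * k + 1)) => J.card ≤ k) Finset.univ =
      (Finset.range (k + 1)).biUnion fun i => Finset.powersetCard i (Finset.univ : Finset (Fin (2 * k + 1))) := by
    ext J
    simp only [Finset.mem_filter, Finset.mem_univ, true_and, Finset.mem_biUnion, Finset.mem_range,
      Finset.mem_powersetCard, Finset.subset_univ]
    constructor
    · intro h; exact ⟨J.card, by omega, rfl⟩
    · rintro ⟨i, hi, hc⟩; omega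
  rw [hdec, Finset.card_biUnion]
  · simp only [Finset.card_powersetCard, Finset.card_univ, Fintype.card_fin]
    rw [Nat.sum_range_choose_halfway k, pow_mul]
    norm_num
  · intro i _ j _ hij
    exact Finset.disjoint_left.2 fun J h1 h2 =>
      hij ((Finset.mem_powersetCard.1 h1).2.symm.trans (Finset.mem_powersetCard.1 h2).2)

/-- at the exact half, an injective THRESHOLD column family (graded-colex) runs through every point `|J| ≤ k`. -/
theorem cols_cover_ball {k r : ℕ} (hr : r = 2 ^ (2 * k)) (cols : Fin r → Finset (Fin (2 * k + 1)))
    (hinj : Function.Injective cols)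
    (hthr : ∀ kk J, J ∉ Set.range cols →
      ∑ q ∈ cols kk, (2 ^ (2 * k + 1) + 2 ^ (q : ℕ)) < ∑ q ∈ J, (2 ^ (2 * k + 1) + 2 ^ (q : ℕ))) :
    ∀ J : Finset (Fin (2 * k + 1)), J.card ≤ k → ∃ kk, cols kk = J := by
  classical
  intro J₀ hJ₀
  by_contra hno
  push Not at hno
  have hJ₀r : J₀ ∉ Set.range cols := by rintro ⟨kk, hkk⟩; exact hno kk hkk
  -- every column set has size `≤ k`
  have hsmall : ∀ kk, (cols kk).card ≤ k := by
    intro kk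
    by_contra hbig
    push Not at hbig
    have h1 := hthr kk J₀ hJ₀r
    have h2 := BallDiag.gcw_lt_of_card_lt (2 * k + 1) J₀ (cols kk) (by omega)
    omega
  -- so the `r` distinct column sets lie in the ball minus `J₀`
  have hsub : (Finset.univ : Finset (Fin r)).image cols ⊆
      (Finset.filter (fun J : Finset (Fin (2 * k + 1)) => J.card ≤ k) Finset.univ).erase J₀ := by
    intro J hJ
    obtain ⟨kk, -, rfl⟩ := Finset.mem_image.1 hJ
    exact Finset.mem_erase.2 ⟨hno kk, Finset.mem_filter.2 ⟨Finset.mem_univ _, hsmall kk⟩⟩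
  have hcard := Finset.card_le_card hsub
  have hmem : J₀ ∈ Finset.filter (fun J : Finset (Fin (2 * k + 1)) => J.card ≤ k) Finset.univ :=
    Finset.mem_filter.2 ⟨Finset.mem_univ _, hJ₀⟩
  rw [Finset.card_image_of_injective _ hinj, Finset.card_univ, Fintype.card_fin,
    Finset.card_erase_of_mem hmem, card_ball_half] at hcard
  have : 0 < 2 ^ (2 * k) := Nat.two_pow_pos _
  omega

/-- ★★ **THE GC½ CELL «swap classes of the first shell», every `k ≥ 2`, in the shape of Conjecture GC½** (hypothesis `H` of
`BallDiag.universalJoinWideLower_upperHalf_of_gc` at `h = 2k+1`, `r = 2^{2k}`, restricted to the row families `u` ranging in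
`B_k − {X} + {Xᶜ}`; lower-set-ness of the range is automatic and not needed). -/
theorem gc_cell_firstShell_swap (k : ℕ) (hk : 2 ≤ k) {r : ℕ} (hr : r = 2 ^ (2 * k))
    (cols : Fin r → Finset (Fin (2 * k + 1))) (hinj : Function.Injective cols)
    (hthr : ∀ kk J, J ∉ Set.range cols →
      ∑ q ∈ cols kk, (2 ^ (2 * k + 1) + 2 ^ (q : ℕ)) < ∑ q ∈ J, (2 ^ (2 * k + 1) + 2 ^ (q : ℕ)))
    (u : Fin r → Finset (Fin (2 * k + 1))) (hu : Function.Injective u)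
    (X : Finset (Fin (2 * k + 1))) (hX : X.card = k) (hU : ∀ i, ((u i).card ≤ k ∧ u i ≠ X) ∨ u i = Xᶜ) :
    ∃ tx : Option (Fin (2 * k + 1)) → Fin (2 * k + 1) → ℂ,
      (Matrix.of fun i kk : Fin r => ∏ a ∈ u i, (tx none a + ∑ q ∈ cols kk, tx (some q) a)).det ≠ 0 :=
  exists_table_firstShell_swap k hk X hX u cols hu hU (cols_cover_ball hr cols hinj hthr)

end PathTable

end

end Summit.ValiantsHypothesis.ValiantsHypothesis.Theorems.BarrierLever.HiddenStates
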